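import Literature.NumberTheory.EllipticCurves.BinaryQuarticJacobianIdentity
import Mathlib.Analysis.SpecialFunctions.Trigonometric.Deriv
import Mathlib.Analysis.Calculus.Deriv.Inv
import Mathlib.Analysis.Calculus.Deriv.Pow
import Mathlib.Analysis.Calculus.Deriv.Prod
import Mathlib.Analysis.SpecialFunctions.Sqrt
import HarnessLib

/-!
# One-parameter subgroups of `SL₂(ℝ)`, the derivative of the substitution action, and the Jacobian determinant in Iwasawa coordinates

Topic `Literature/NumberTheory/EllipticCurves`; continues `BinaryQuarticJacobianIdentity.lean`
(the infinitesimal action `lieDeriv`, `dI`, `dJ` and the section-independence identity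
`27 det[w₁; w₂; ℒ_e f; ℒ_h f; ℒ_f f] = 2 (dI ∧ dJ)(w₁, w₂)`). Everything here is PROVED (no
named facts). It supplies the calculus and the algebra for the change of variables
`(g, p) ↦ g · p` of Bhargava–Shankar, Props. 2.7–2.8 (Ann. of Math. 181 (2015); arXiv:1006.1002v2
numbering), carried out in the Iwasawa coordinates `g = (ñ(x) ã(y) k(θ))⁻¹` of
`Literature/MeasureTheory/Group/SL2IwasawaHaar.lean`:

* the one-parameter subgroups `upperShear s = ñ(s) = (1 s; 0 1)`, `diagTorus u = a(u) =
  diag(u, u⁻¹)`, `rotR t = k(t)` and **the derivative of `t ↦ f ∘ γ(t)` through the identity**: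
  `hasDerivAt_coeffs_subst_path` (any differentiable matrix path with `γ(t₀) = 1`, `γ'(t₀) = X`
  has `(d/dt)(f ∘ γ)|_{t₀} = ℒ_X f`), specialised to `ñ`, `a`, `k` (`ℒ_e`, `ℒ_h`, `ℒ_w`);
* the inverse Iwasawa matrix `iwasawaG x y θ = k(−θ) a(1/√y) ñ(−x)`, its inverse/adjugate
  `iwasawaGinv`, and the factorisations of its variations in `x`, `y`, `θ` through the three
  subgroups (`iwasawaG_add_x`, `iwasawaG_add_y`, `iwasawaG_add_theta`), with
  `Ad(G⁻¹) w = (−x/y, y + x²/y; −1/y, x/y)` (`iwasawaGinv_w_iwasawaG`) and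
  `ñ(x) h ñ(−x) = h − 2xe`;
* **the Jacobian determinant** (`det_rows_iwasawa`): for the derivative rows `−ℒ_e f`,
  `−c ℒ_{h−2xe} f`, `−ℒ_Z f` (`Z = (−xv, y + x²v; −v, xv)`) and two arbitrary rows `w₁, w₂`,
  `27 det = 2 c v (dI_f(w₁) dJ_f(w₂) − dI_f(w₂) dJ_f(w₁))`; with `c = 1/(2y)`, `v = 1/y` this is
  `det = (1/27) y⁻² (dI ∧ dJ)(w₁, w₂)`, i.e. Bhargava–Shankar's `(2/27) dg dI dJ` for their Haar
  measure `dg`, which is one half of `y⁻² dx dy dθ`.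

## References

* M. Bhargava, A. Shankar, Ann. of Math. (2) 181 (2015) 191–242, Props. 2.7–2.8
  (arXiv:1006.1002v2 numbering). [cite: BhargavaShankarAnnals2015, Props. 2.7–2.8 (the Jacobian computation; arXiv:1006.1002v2 numbering)]
-/

noncomputable section

open Real

namespace Literature.NumberTheory.EllipticCurves

namespace BinaryQuartic

/-! ## The three one-parameter subgroups `ñ(s)`, `a(u)`, `k(t)` -/

/-- The upper shear `ñ(s) = (1 s; 0 1) = 1 + s e`. [folklore] -/
def upperShear (s : ℝ) : Matrix (Fin 2) (Fin 2) ℝ := !![1, s; 0, 1]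

/-- The split torus `a(u) = diag(u, u⁻¹)`. [folklore] -/
def diagTorus (u : ℝ) : Matrix (Fin 2) (Fin 2) ℝ := !![u, 0; 0, u⁻¹]

/-- The rotation `k(t) = (cos t, sin t; −sin t, cos t)`. [folklore] -/
def rotR (t : ℝ) : Matrix (Fin 2) (Fin 2) ℝ := !![cos t, sin t; -sin t, cos t]

/-! ## The derivative of `t ↦ f ∘ γ(t)` along a differentiable matrix path -/

section Path

variable {p q r s : ℝ → ℝ} {p' q' r' s' t₀ : ℝ}

/-- **The derivative of the substitution action along a matrix path through the identity is the
infinitesimal action**: if `γ(t) = (p q; r s)(t)` is differentiable at `t₀` with `γ(t₀) = 1` and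
`γ'(t₀) = X`, then `(d/dt) (f ∘ γ(t))|_{t₀} = ℒ_X f` (this is the defining property of
`lieDeriv`, certified exactly over the dual numbers by `subst_one_add_eps`). [folklore] -/
theorem hasDerivAt_coeffs_subst_path (f : BinaryQuartic ℝ) (hp : HasDerivAt p p' t₀)
    (hq : HasDerivAt q q' t₀) (hr : HasDerivAt r r' t₀) (hs : HasDerivAt s s' t₀)
    (h1 : p t₀ = 1) (h2 : q t₀ = 0) (h3 : r t₀ = 0) (h4 : s t₀ = 1) :
    HasDerivAt (fun t => (f.subst !![p t, q t; r t, s t]).coeffs)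
      (lieDeriv !![p', q'; r', s'] f).coeffs t₀ := by
  have M := fun (c : ℝ) (i j k l : ℕ) =>
    ((((hp.fun_pow i).fun_mul (hq.fun_pow j)).fun_mul (hr.fun_pow k)).fun_mul (hs.fun_pow l)).const_mul c
  refine hasDerivAt_pi.2 fun ι => ?_
  fin_cases ι
  · -- `a' = a p⁴ + b p³q + c p²q² + d p q³ + e q⁴`
    have h := (((M f.a 4 0 0 0).add (M f.b 3 1 0 0)).add (M f.c 2 2 0 0)).add (M f.d 1 3 0 0)
      |>.add (M f.e 0 4 0 0)
    convert h using 1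
    · funext t
      simp only [coeffs, subst, Matrix.of_apply, Matrix.cons_val', Matrix.cons_val_zero,
        Matrix.cons_val_one, Matrix.cons_val_fin_one, Fin.zero_eta, Fin.isValue, Pi.add_apply]
      ring
    · simp [coeffs, lieDeriv, h1, h2, h3, h4]
      ring
  · -- `b' = 4a p³r + b p³s + 3b p²qr + 2c p²qs + 2c pq²r + 3d pq²s + d q³r + 4e q³s`
    have h := (((((((M (4 * f.a) 3 0 1 0).add (M f.b 3 0 0 1)).add (M (3 * f.b) 2 1 1 0)).add
      (M (2 * f.c) 2 1 0 1)).add (M (2 * f.c) 1 2 1 0)).add (M (3 * f.d) 1 2 0 1)).add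
      (M f.d 0 3 1 0)).add (M (4 * f.e) 0 3 0 1)
    convert h using 1
    · funext t
      simp only [coeffs, subst, Matrix.of_apply, Matrix.cons_val', Matrix.cons_val_zero,
        Matrix.cons_val_one, Matrix.cons_val_fin_one, Fin.mk_one, Fin.isValue, Pi.add_apply]
      ring
    · simp [coeffs, lieDeriv, h1, h2, h3, h4]
      ring
  · -- `c' = 6a p²r² + 3b p²rs + 3b pqr² + c p²s² + 4c pqrs + c q²r² + 3d pqs² + 3d q²rs + 6e q²s²`
    have h := ((((((((M (6 * f.a) 2 0 2 0).add (M (3 * f.b) 2 0 1 1)).add (M (3 * f.b) 1 1 2 0)).add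
      (M f.c 2 0 0 2)).add (M (4 * f.c) 1 1 1 1)).add (M f.c 0 2 2 0)).add (M (3 * f.d) 1 1 0 2)).add
      (M (3 * f.d) 0 2 1 1)).add (M (6 * f.e) 0 2 0 2)
    convert h using 1
    · funext t
      simp only [coeffs, subst, Matrix.of_apply, Matrix.cons_val', Matrix.cons_val_zero,
        Matrix.cons_val_one, Matrix.cons_val_fin_one, Fin.reduceFinMk, Fin.isValue, Pi.add_apply,
        Matrix.cons_val]
      ring
    · simp [coeffs, lieDeriv, h1, h2, h3, h4]
      ring
  · -- `d' = 4a pr³ + 3b pr²s + b qr³ + 2c prs² + 2c qr²s + d ps³ + 3d qrs² + 4e qs³`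
    have h := (((((((M (4 * f.a) 1 0 3 0).add (M (3 * f.b) 1 0 2 1)).add (M f.b 0 1 3 0)).add
      (M (2 * f.c) 1 0 1 2)).add (M (2 * f.c) 0 1 2 1)).add (M f.d 1 0 0 3)).add
      (M (3 * f.d) 0 1 1 2)).add (M (4 * f.e) 0 1 0 3)
    convert h using 1
    · funext t
      simp only [coeffs, subst, Matrix.of_apply, Matrix.cons_val', Matrix.cons_val_zero,
        Matrix.cons_val_one, Matrix.cons_val_fin_one, Fin.reduceFinMk, Fin.isValue, Pi.add_apply,
        Matrix.cons_val]
      ring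
    · simp [coeffs, lieDeriv, h1, h2, h3, h4]
      ring
  · -- `e' = a r⁴ + b r³s + c r²s² + d rs³ + e s⁴`
    have h := ((((M f.a 0 0 4 0).add (M f.b 0 0 3 1)).add (M f.c 0 0 2 2)).add (M f.d 0 0 1 3)).add
      (M f.e 0 0 0 4)
    convert h using 1
    · funext t
      simp only [coeffs, subst, Matrix.of_apply, Matrix.cons_val', Matrix.cons_val_zero,
        Matrix.cons_val_one, Matrix.cons_val_fin_one, Fin.reduceFinMk, Fin.isValue, Pi.add_apply,
        Matrix.cons_val]
      ring
    · simp [coeffs, lieDeriv, h1, h2, h3, h4]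
      ring

end Path

/-- **`(d/ds) f ∘ ñ(s) |_{s=0} = ℒ_e f`.** [folklore] -/
theorem hasDerivAt_coeffs_subst_upperShear (f : BinaryQuartic ℝ) :
    HasDerivAt (fun s => (f.subst (upperShear s)).coeffs) (lieDeriv !![0, 1; 0, 0] f).coeffs 0 :=
  hasDerivAt_coeffs_subst_path f (hasDerivAt_const 0 1) (hasDerivAt_id 0) (hasDerivAt_const 0 0)
    (hasDerivAt_const 0 1) rfl rfl rfl rfl

/-- **`(d/du) f ∘ a(u) |_{u=1} = ℒ_h f`.** [folklore] -/
theorem hasDerivAt_coeffs_subst_diagTorus (f : BinaryQuartic ℝ) :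
    HasDerivAt (fun u => (f.subst (diagTorus u)).coeffs) (lieDeriv !![1, 0; 0, -1] f).coeffs 1 := by
  have hinv : HasDerivAt (fun u : ℝ => u⁻¹) (-1) 1 := by
    simpa using hasDerivAt_inv (one_ne_zero (α := ℝ))
  exact hasDerivAt_coeffs_subst_path f (hasDerivAt_id 1) (hasDerivAt_const 1 0)
    (hasDerivAt_const 1 0) hinv rfl rfl rfl (by simp)

/-- **`(d/dt) f ∘ k(t) |_{t=0} = ℒ_w f`**, `w = (0 1; −1 0)`. [folklore] -/
theorem hasDerivAt_coeffs_subst_rotR (f : BinaryQuartic ℝ) :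
    HasDerivAt (fun t => (f.subst (rotR t)).coeffs) (lieDeriv !![0, 1; -1, 0] f).coeffs 0 := by
  have hc := Real.hasDerivAt_cos 0
  have hs := Real.hasDerivAt_sin 0
  simp only [Real.sin_zero, neg_zero, Real.cos_zero] at hc hs
  have hns : HasDerivAt (fun t => -Real.sin t) (-1) 0 := by
    have h : HasDerivAt (fun t => -Real.sin t) (-Real.cos 0) 0 := (Real.hasDerivAt_sin 0).neg
    rwa [Real.cos_zero] at h
  exact hasDerivAt_coeffs_subst_path f hc hs hns hc Real.cos_zero Real.sin_zero (by simp)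
    Real.cos_zero

/-! ## The determinant identity in Iwasawa coordinates -/

section DetIdentity

variable {R : Type*} [CommRing R]

/-- The `5 × 5` determinant of the Jacobian rows in Iwasawa coordinates, explicitly: with
`Z = (−xv, y + x²v; −v, xv)` (`v = 1/y`) and a scalar `c` (`= 1/(2y)`),
`27 · det[−ℒ_e f; −c ℒ_{h − 2x e} f; −ℒ_Z f; p; q] = 2 c v (dI_f(p) dJ_f(q) − dI_f(q) dJ_f(p))`.
[folklore] -/
theorem det_rows_iwasawa_explicit (f : BinaryQuartic R) (x y v c : R)
    (p0 p1 p2 p3 p4 q0 q1 q2 q3 q4 : R) :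
    27 * (Matrix.of ![
        ![-f.b, -(2 * f.c), -(3 * f.d), -(4 * f.e), 0],
        ![-c * (4 * f.a - 2 * x * f.b), -c * (2 * f.b - 2 * x * (2 * f.c)), -c * (0 - 2 * x * (3 * f.d)),
          -c * (-2 * f.d - 2 * x * (4 * f.e)), -c * (-4 * f.e)],
        ![-(4 * f.a * (-(x * v)) + f.b * (y + x ^ 2 * v)),
          -(3 * f.b * (-(x * v)) + f.b * (x * v) + 4 * f.a * (-v) + 2 * f.c * (y + x ^ 2 * v)),
          -(2 * f.c * (-(x * v)) + 2 * f.c * (x * v) + 3 * f.b * (-v) + 3 * f.d * (y + x ^ 2 * v)),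
          -(f.d * (-(x * v)) + 3 * f.d * (x * v) + 2 * f.c * (-v) + 4 * f.e * (y + x ^ 2 * v)),
          -(4 * f.e * (x * v) + f.d * (-v))],
        ![p0, p1, p2, p3, p4], ![q0, q1, q2, q3, q4]]).det =
      2 * c * v * ((12 * (f.a * p4 + f.e * p0) - 3 * (f.b * p3 + f.d * p1) + 2 * f.c * p2) *
            (72 * (q0 * f.c * f.e + f.a * q2 * f.e + f.a * f.c * q4)
              + 9 * (q1 * f.c * f.d + f.b * q2 * f.d + f.b * f.c * q3)
              - 27 * (q0 * f.d ^ 2 + 2 * f.a * f.d * q3)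
              - 27 * (q4 * f.b ^ 2 + 2 * f.e * f.b * q1) - 6 * f.c ^ 2 * q2)
          - (12 * (f.a * q4 + f.e * q0) - 3 * (f.b * q3 + f.d * q1) + 2 * f.c * q2) *
            (72 * (p0 * f.c * f.e + f.a * p2 * f.e + f.a * f.c * p4)
              + 9 * (p1 * f.c * f.d + f.b * p2 * f.d + f.b * f.c * p3)
              - 27 * (p0 * f.d ^ 2 + 2 * f.a * f.d * p3)
              - 27 * (p4 * f.b ^ 2 + 2 * f.e * f.b * p1) - 6 * f.c ^ 2 * p2)) := by
  simp only [Matrix.det_succ_row_zero, Matrix.det_isEmpty, Fin.sum_univ_succ, Fin.sum_univ_zero,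
    Matrix.submatrix_apply, Matrix.of_apply, Matrix.cons_val_zero, Matrix.cons_val_succ,
    Fin.zero_succAbove, Fin.succ_succAbove_zero, Fin.succ_succAbove_succ, Fin.val_zero,
    Fin.val_succ, pow_zero, pow_succ]
  ring

/-- Coefficients of a scalar multiple. [folklore] -/
theorem coeffs_smul' (c : R) (f : BinaryQuartic R) : (c • f).coeffs = c • f.coeffs := by
  ext i; fin_cases i <;> simp [coeffs]

/-- **The Jacobian determinant in Iwasawa coordinates** (structured form of
`det_rows_iwasawa_explicit`): for the rows `−ℒ_e f`, `−c ℒ_{h−2xe} f`, `−ℒ_Z f`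
(`Z = (−xv, y + x²v; −v, xv)`) followed by two arbitrary rows,
`27 · det = 2 c v (dI_f(w₁) dJ_f(w₂) − dI_f(w₂) dJ_f(w₁))`. With `c = 1/(2y)`, `v = 1/y` these
are the derivative directions of `(x, y, θ) ↦ (ñ(x) ã(y) k(θ))⁻¹ · f` and the determinant is
`(1/27) y⁻² · (dI ∧ dJ)(w₁, w₂)` — Bhargava–Shankar's Jacobian `(2/27) dg dI dJ` for
`dg = (1/2) y⁻² dx dy dθ`. [cite: BhargavaShankarAnnals2015, Props. 2.7–2.8 (arXiv:1006.1002v2 numbering)] -/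
theorem det_rows_iwasawa (f w₁ w₂ : BinaryQuartic R) (x y v c : R) :
    27 * (Matrix.of ![((-1 : R) • lieDeriv !![0, 1; 0, 0] f).coeffs,
        ((-c) • lieDeriv !![1, -(2 * x); 0, -1] f).coeffs,
        ((-1 : R) • lieDeriv !![-(x * v), y + x ^ 2 * v; -v, x * v] f).coeffs,
        w₁.coeffs, w₂.coeffs]).det =
      2 * c * v * (dI f w₁ * dJ f w₂ - dI f w₂ * dJ f w₁) := by
  have e1 : ((-1 : R) • lieDeriv !![0, 1; 0, 0] f).coeffs =
      ![-f.b, -(2 * f.c), -(3 * f.d), -(4 * f.e), 0] := by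
    ext i; fin_cases i <;> simp [coeffs, lieDeriv, mul_comm]
  have e2 : ((-c) • lieDeriv !![1, -(2 * x); 0, -1] f).coeffs =
      ![-c * (4 * f.a - 2 * x * f.b), -c * (2 * f.b - 2 * x * (2 * f.c)), -c * (0 - 2 * x * (3 * f.d)),
        -c * (-2 * f.d - 2 * x * (4 * f.e)), -c * (-4 * f.e)] := by
    ext i; fin_cases i <;> simp [coeffs, lieDeriv] <;> ring_nf
  have e3 : ((-1 : R) • lieDeriv !![-(x * v), y + x ^ 2 * v; -v, x * v] f).coeffs =
      ![-(4 * f.a * (-(x * v)) + f.b * (y + x ^ 2 * v)),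
        -(3 * f.b * (-(x * v)) + f.b * (x * v) + 4 * f.a * (-v) + 2 * f.c * (y + x ^ 2 * v)),
        -(2 * f.c * (-(x * v)) + 2 * f.c * (x * v) + 3 * f.b * (-v) + 3 * f.d * (y + x ^ 2 * v)),
        -(f.d * (-(x * v)) + 3 * f.d * (x * v) + 2 * f.c * (-v) + 4 * f.e * (y + x ^ 2 * v)),
        -(4 * f.e * (x * v) + f.d * (-v))] := by
    ext i; fin_cases i <;> simp [coeffs, lieDeriv]
  rw [e1, e2, e3]
  have h := det_rows_iwasawa_explicit f x y v c w₁.a w₁.b w₁.c w₁.d w₁.e w₂.a w₂.b w₂.c w₂.d w₂.e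
  simp only [coeffs] at h ⊢
  rw [h]
  simp only [dI, dJ]

end DetIdentity

/-! ## Group-theoretic identities for `ñ`, `a`, `k` and the inverse Iwasawa matrix -/

section Group

/-- `ñ(s) ñ(t) = ñ(s + t)`. [folklore] -/
theorem upperShear_mul (s t : ℝ) : upperShear s * upperShear t = upperShear (s + t) := by
  ext i j; fin_cases i <;> fin_cases j <;> simp [upperShear, Matrix.mul_apply, Fin.sum_univ_two]; ring

/-- `det ñ(s) = 1`. [folklore] -/
theorem det_upperShear_eq_one (s : ℝ) : (upperShear s).det = 1 := by
  simp [upperShear, Matrix.det_fin_two_of]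

/-- `adj ñ(s) = ñ(−s)`. [folklore] -/
theorem adjugate_upperShear (s : ℝ) : (upperShear s).adjugate = upperShear (-s) := by
  ext i j; fin_cases i <;> fin_cases j <;> simp [upperShear, Matrix.adjugate_fin_two_of]

/-- `a(u) a(w) = a(uw)`. [folklore] -/
theorem diagTorus_mul (u w : ℝ) : diagTorus u * diagTorus w = diagTorus (u * w) := by
  ext i j; fin_cases i <;> fin_cases j <;> simp [diagTorus, Matrix.mul_apply, Fin.sum_univ_two, mul_comm]

/-- `a(1) = 1`. [folklore] -/
theorem diagTorus_one : diagTorus 1 = 1 := by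
  ext i j; fin_cases i <;> fin_cases j <;> simp [diagTorus]

/-- `det a(u) = 1` for `u ≠ 0`. [folklore] -/
theorem det_diagTorus {u : ℝ} (hu : u ≠ 0) : (diagTorus u).det = 1 := by
  simp [diagTorus, Matrix.det_fin_two_of, hu]

/-- `k(a + b) = k(a) k(b)`. [folklore] -/
theorem rotR_add (a b : ℝ) : rotR (a + b) = rotR a * rotR b := by
  ext i j
  fin_cases i <;> fin_cases j <;>
    simp [rotR, Matrix.mul_apply, Fin.sum_univ_two, Real.cos_add, Real.sin_add] <;> ring

/-- `k(0) = 1`. [folklore] -/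
theorem rotR_zero : rotR 0 = 1 := by
  ext i j; fin_cases i <;> fin_cases j <;> simp [rotR]

/-- `det k(t) = 1`. [folklore] -/
theorem det_rotR (t : ℝ) : (rotR t).det = 1 := by
  rw [rotR, Matrix.det_fin_two_of]
  nlinarith [Real.sin_sq_add_cos_sq t]

/-- `ñ(x) h ñ(−x) = h − 2x e`. [folklore] -/
theorem upperShear_h_conj (x : ℝ) :
    upperShear x * !![1, 0; 0, -1] * upperShear (-x) = !![1, -(2 * x); 0, -1] := by
  ext i j; fin_cases i <;> fin_cases j <;> simp [upperShear, Matrix.mul_apply, Fin.sum_univ_two]; ring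

/-- The inverse Iwasawa matrix `G(x, y, θ) = (ñ(x) ã(y) k(θ))⁻¹ = k(−θ) a(1/√y) ñ(−x)`, the group
element substituted into the forms. [folklore] -/
def iwasawaG (x y θ : ℝ) : Matrix (Fin 2) (Fin 2) ℝ :=
  rotR (-θ) * diagTorus (Real.sqrt y)⁻¹ * upperShear (-x)

/-- `ñ(x) ã(y) k(θ)` written with the one-parameter subgroups. [folklore] -/
def iwasawaGinv (x y θ : ℝ) : Matrix (Fin 2) (Fin 2) ℝ :=
  upperShear x * diagTorus (Real.sqrt y) * rotR θ

/-- `(ñ(x) ã(y) k(θ)) · G(x,y,θ) = 1`. [folklore] -/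
theorem iwasawaGinv_mul_iwasawaG {x y : ℝ} (hy : 0 < y) (θ : ℝ) :
    iwasawaGinv x y θ * iwasawaG x y θ = 1 := by
  have hs : Real.sqrt y ≠ 0 := (Real.sqrt_pos.2 hy).ne'
  rw [iwasawaGinv, iwasawaG]
  calc upperShear x * diagTorus (Real.sqrt y) * rotR θ * (rotR (-θ) * diagTorus (Real.sqrt y)⁻¹ * upperShear (-x))
      = upperShear x * (diagTorus (Real.sqrt y) * ((rotR θ * rotR (-θ)) * diagTorus (Real.sqrt y)⁻¹)) * upperShear (-x) := by
        simp only [Matrix.mul_assoc]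
    _ = 1 := by
        rw [← rotR_add, add_neg_cancel, rotR_zero, Matrix.one_mul, diagTorus_mul,
          mul_inv_cancel₀ hs, diagTorus_one, Matrix.mul_one, upperShear_mul, add_neg_cancel]
        ext i j; fin_cases i <;> fin_cases j <;> simp [upperShear]

/-- `G(x,y,θ) · (ñ(x) ã(y) k(θ)) = 1`. [folklore] -/
theorem iwasawaG_mul_iwasawaGinv {x y : ℝ} (hy : 0 < y) (θ : ℝ) :
    iwasawaG x y θ * iwasawaGinv x y θ = 1 :=
  mul_eq_one_comm.1 (iwasawaGinv_mul_iwasawaG hy θ)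

/-- `det G(x,y,θ) = 1`. [folklore] -/
theorem det_iwasawaG {x y : ℝ} (hy : 0 < y) (θ : ℝ) : (iwasawaG x y θ).det = 1 := by
  have hs : (Real.sqrt y)⁻¹ ≠ 0 := inv_ne_zero (Real.sqrt_pos.2 hy).ne'
  rw [iwasawaG, Matrix.det_mul, Matrix.det_mul, det_rotR, det_diagTorus hs, det_upperShear_eq_one]; ring

/-- `adj G = G⁻¹ = ñ(x) ã(y) k(θ)`. [folklore] -/
theorem adjugate_iwasawaG {x y : ℝ} (hy : 0 < y) (θ : ℝ) :
    (iwasawaG x y θ).adjugate = iwasawaGinv x y θ := by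
  have h1 := det_iwasawaG hy θ (x := x)
  have hinv : (iwasawaG x y θ)⁻¹ = iwasawaGinv x y θ :=
    Matrix.inv_eq_left_inv (iwasawaGinv_mul_iwasawaG hy θ)
  rw [← hinv, Matrix.inv_def, h1, Ring.inverse_one, one_smul]

/-- **`Ad(g) w` in Iwasawa coordinates**: `G⁻¹ w G = (−x/y, y + x²/y; −1/y, x/y)` for
`G = (ñ(x) ã(y) k(θ))⁻¹`, `w = (0 1; −1 0)` (the direction of the `θ`-derivative). [folklore] -/
theorem iwasawaGinv_w_iwasawaG {x y : ℝ} (hy : 0 < y) (θ : ℝ) :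
    iwasawaGinv x y θ * !![0, 1; -1, 0] * iwasawaG x y θ =
      !![-(x * y⁻¹), y + x ^ 2 * y⁻¹; -y⁻¹, x * y⁻¹] := by
  have hs0 : Real.sqrt y ≠ 0 := (Real.sqrt_pos.2 hy).ne'
  have hsq : Real.sqrt y ^ 2 = y := Real.sq_sqrt hy.le
  have hcs := Real.sin_sq_add_cos_sq θ
  ext i j
  fin_cases i <;> fin_cases j
  · simp [iwasawaGinv, iwasawaG, upperShear, diagTorus, rotR, Matrix.mul_apply, Fin.sum_univ_two,
      Real.cos_neg, Real.sin_neg]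
    field_simp
    rw [hsq]
    linear_combination (-(x * y)) * hcs
  · simp [iwasawaGinv, iwasawaG, upperShear, diagTorus, rotR, Matrix.mul_apply, Fin.sum_univ_two,
      Real.cos_neg, Real.sin_neg]
    field_simp
    rw [hsq]
    linear_combination (x ^ 2 * y + y ^ 3) * hcs
  · simp [iwasawaGinv, iwasawaG, upperShear, diagTorus, rotR, Matrix.mul_apply, Fin.sum_univ_two,
      Real.cos_neg, Real.sin_neg]
    field_simp
    rw [hsq]
    linear_combination (-y) * hcs
  · simp [iwasawaGinv, iwasawaG, upperShear, diagTorus, rotR, Matrix.mul_apply, Fin.sum_univ_two,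
      Real.cos_neg, Real.sin_neg]
    field_simp
    rw [hsq]
    linear_combination (x * y) * hcs

/-- Varying `x`: `G(x + t) = G(x) ñ(−t)`. [folklore] -/
theorem iwasawaG_add_x (x y θ t : ℝ) : iwasawaG (x + t) y θ = iwasawaG x y θ * upperShear (-t) := by
  rw [iwasawaG, iwasawaG, Matrix.mul_assoc (rotR (-θ) * diagTorus (Real.sqrt y)⁻¹) (upperShear (-x)),
    upperShear_mul, neg_add]

/-- Varying `θ`: `G(θ + t) = k(−t) G(θ)`. [folklore] -/
theorem iwasawaG_add_theta (x y θ t : ℝ) : iwasawaG x y (θ + t) = rotR (-t) * iwasawaG x y θ := by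
  rw [iwasawaG, iwasawaG, neg_add, add_comm, rotR_add]
  simp only [Matrix.mul_assoc]

/-- Varying `y`: `G(y + t) = G(y) · ñ(x) a(√y/√(y+t)) ñ(−x)` (a conjugate of the torus).
[folklore] -/
theorem iwasawaG_add_y {x y t : ℝ} (hy : 0 < y) (hyt : 0 < y + t) (θ : ℝ) :
    iwasawaG x (y + t) θ =
      iwasawaG x y θ * (upperShear x * diagTorus (Real.sqrt y / Real.sqrt (y + t)) * upperShear (-x)) := by
  have hs : Real.sqrt y ≠ 0 := (Real.sqrt_pos.2 hy).ne'
  have hst : Real.sqrt (y + t) ≠ 0 := (Real.sqrt_pos.2 hyt).ne'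
  rw [iwasawaG, iwasawaG]
  calc rotR (-θ) * diagTorus (Real.sqrt (y + t))⁻¹ * upperShear (-x)
      = rotR (-θ) * (diagTorus (Real.sqrt y)⁻¹ * diagTorus (Real.sqrt y / Real.sqrt (y + t))) *
          upperShear (-x) := by
        rw [diagTorus_mul]; congr 2; field_simp
    _ = rotR (-θ) * diagTorus (Real.sqrt y)⁻¹ * upperShear (-x) *
          (upperShear x * diagTorus (Real.sqrt y / Real.sqrt (y + t)) * upperShear (-x)) := by
        have e : upperShear (-x) * upperShear x = 1 := by
          rw [upperShear_mul, neg_add_cancel]; ext i j; fin_cases i <;> fin_cases j <;> simp [upperShear]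
        simp only [Matrix.mul_assoc]
        rw [← Matrix.mul_assoc (upperShear (-x)) (upperShear x), e, Matrix.one_mul]

/-- The derivative of the torus parameter `u(t) = √y / √(y + t)` at `t = 0` is `−1/(2y)`.
[folklore] -/
theorem hasDerivAt_sqrt_div_sqrt {y : ℝ} (hy : 0 < y) :
    HasDerivAt (fun t => Real.sqrt y / Real.sqrt (y + t)) (-(1 / (2 * y))) 0 := by
  have h1 : HasDerivAt (fun t => y + t) 1 0 := by simpa using (hasDerivAt_id (0 : ℝ)).const_add y
  have h2 : HasDerivAt (fun t => Real.sqrt (y + t)) (1 / (2 * Real.sqrt (y + 0))) 0 :=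
    h1.sqrt (by simpa using hy.ne')
  have hs : Real.sqrt y ≠ 0 := (Real.sqrt_pos.2 hy).ne'
  have hsq : Real.sqrt y ^ 2 = y := Real.sq_sqrt hy.le
  have h3 := (hasDerivAt_const (0 : ℝ) (Real.sqrt y)).div h2 (by simpa using hs)
  refine h3.congr_deriv ?_
  simp only [add_zero]
  field_simp
  rw [hsq]
  ring

end Group

end BinaryQuartic

end Literature.NumberTheory.EllipticCurves

end
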